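import Summits.Schanuel.Schanuel.Theorems.SoloInformedStructuredNonConjugate
import Summits.Schanuel.Schanuel.Theorems.SoloInformedDilatedFactor

/-!
# Generic Gel'fond input from structured roots of an auxiliary polynomial

Soloist file (informed mode, seat `solo-Schanuel-informed`, s180).  The generic form of Steps
4–5 of the seat's THEOREM AE-1 (`paper/AE-note.md` §7; tree file `SoloInformedAE1GelfondInput`
is the special case `R = P ∈ RoyAdditiveSmall`, `D₀ = n`, `L₀ = 2 n^β`), to be fed with the
output of `soloGS_structured_roots` in the proofs of THEOREMS AE-1τ and AE-2 (`AE-note.md` §9;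
[cite: Roy2010, §1 p. 4, steps (3)–(4) and Thm 1.1]).

`soloGG_gelfond_input`: let `ξ` be transcendental, `K ≥ 1000`, `R ∈ ℤ[X]` non-zero with
`deg R ≤ D₀`, `log M(R) ≤ L₀` (`D₀, L₀ > 0`), and suppose `R(γ + sμ) = 0`,
`‖γ + sμ - sξ‖ ≤ exp(-W)` for all `s` in a set `S' ⊆ [1, K]` of size `≥ (49/50) K`, `μ ≠ 0`.
If `(20 D₀ / K) log (K‖ξ‖ + 1) + 20 L₀ / K ≤ W / 2` then there is a non-zero `Q ∈ ℤ[X]` with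
`deg Q ≤ 20 D₀ / K`, Gel'fond type `t(Q) ≤ (20 D₀ / K)(2 + log K) + 20 L₀ / K` and
`‖Q(ξ)‖ ≤ exp(-W/2)`.  Chain: `soloNC_exists_cheap_factor_on_progression` (Lemma H +
pigeonhole: a root `γ + sμ` on an irreducible factor `q ∣ R` of degree `≤ 20 D₀/K` and
`log M(q) ≤ 20 L₀/K`), then `soloDF_package` (the dilated polynomial `q(sT)`).

What this is NOT.  No small value estimate is proved here and nothing bears on
`Literature.Periods.SchanuelConjecture` (the seat's verdict, no path, is unchanged); the node
[cite: Roy2010, Thm 1.1] is not claimed.  Tree files and Mathlib only; no definitions, no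
literature hypothesis; axioms the standard three.
-/

namespace Summit.Schanuel.Schanuel.Theorems

open Polynomial Finset

/-- **Generic Gel'fond input (AE-note §7 Steps 4–5 for an auxiliary `R`).**  See the module
docstring for the statement in words. -/
theorem soloGG_gelfond_input {ξ : ℂ} (hξ : Transcendental ℚ ξ) {K : ℕ} (hK : 1000 ≤ K)
    {R : ℤ[X]} (hR0 : R ≠ 0) {D₀ L₀ : ℝ} (hD₀ : 0 < D₀) (hL₀ : 0 < L₀)
    (hD : (R.natDegree : ℝ) ≤ D₀) (hL : Real.log (R.map (Int.castRingHom ℂ)).mahlerMeasure ≤ L₀)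
    {W : ℝ} {S' : Finset ℕ} (hS'sub : S' ⊆ Icc 1 K) (hS'card : (49 : ℝ) / 50 * K ≤ #S')
    {γ μ : ℂ} (hμ : μ ≠ 0)
    (hroots : ∀ s ∈ S', aeval (γ + (s : ℂ) * μ) R = 0 ∧
      ‖(γ + (s : ℂ) * μ) - (s : ℂ) * ξ‖ ≤ Real.exp (-W))
    (h₆ : 20 * D₀ / K * Real.log (K * ‖ξ‖ + 1) + 20 * L₀ / K ≤ W / 2) :
    ∃ Q : ℤ[X], Q ≠ 0 ∧ (Q.natDegree : ℝ) ≤ 20 * D₀ / K ∧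
      Q.gelfondType ≤ 20 * D₀ / K * (2 + Real.log K) + 20 * L₀ / K ∧
      ‖aeval ξ Q‖ ≤ Real.exp (-(W / 2)) := by
  have hK0 : (0 : ℝ) < K := by exact_mod_cast (show 0 < K by omega)
  have hK1 : (1 : ℝ) ≤ K := by exact_mod_cast (show 1 ≤ K by omega)
  -- Step 4: a cheap irreducible factor through one of the structured roots
  have hd₀ : (0 : ℝ) < 20 * D₀ / K := by positivity
  have hh₀ : (0 : ℝ) < 20 * L₀ / K := by positivity
  have hlogM0 : 0 ≤ Real.log (R.map (Int.castRingHom ℂ)).mahlerMeasure :=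
    Real.log_nonneg (Polynomial.one_le_mahlerMeasure_of_ne_zero hR0)
  have hbudget : 2 * (R.natDegree / (20 * D₀ / K) +
      Real.log (R.map (Int.castRingHom ℂ)).mahlerMeasure / (20 * L₀ / K)) < #S' := by
    have hd : (R.natDegree : ℝ) / (20 * D₀ / K) ≤ K / 20 := by
      rw [div_le_iff₀ hd₀]
      calc (R.natDegree : ℝ) ≤ D₀ := hD
        _ = K / 20 * (20 * D₀ / K) := by field_simp
    have hh : Real.log (R.map (Int.castRingHom ℂ)).mahlerMeasure / (20 * L₀ / K) ≤ K / 20 := by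
      rw [div_le_iff₀ hh₀]
      calc Real.log (R.map (Int.castRingHom ℂ)).mahlerMeasure ≤ L₀ := hL
        _ = K / 20 * (20 * L₀ / K) := by field_simp
    linarith
  obtain ⟨s, hs, q, hqirr, -, -, hqval, hqd, hqh⟩ :=
    soloNC_exists_cheap_factor_on_progression R hR0 γ μ hμ S' (fun s hs => (hroots s hs).1)
      hd₀ hh₀ hbudget
  have hq0 : q ≠ 0 := hqirr.ne_zero
  have hs1 : 1 ≤ s := (Finset.mem_Icc.mp (hS'sub hs)).1
  have hsK : s ≤ K := (Finset.mem_Icc.mp (hS'sub hs)).2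
  -- Step 5: the dilated factor `q(sT)`
  obtain ⟨Q, hQ0, hQdeg, hQtype, -, hQval⟩ :=
    soloDF_package hξ q hq0 hqval hs1 hsK (Real.exp_pos _).le (hroots s hs).2
  refine ⟨Q, hQ0, ?_, ?_, ?_⟩
  · rw [hQdeg]; exact hqd
  · have hlogK : 0 ≤ 2 + Real.log K := by linarith [Real.log_nonneg hK1]
    calc Q.gelfondType ≤ q.natDegree * (2 + Real.log K) +
          Real.log (q.map (Int.castRingHom ℂ)).mahlerMeasure := hQtype
      _ ≤ 20 * D₀ / K * (2 + Real.log K) + 20 * L₀ / K :=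
          add_le_add (mul_le_mul_of_nonneg_right hqd hlogK) hqh
  · have hM0 : 0 < (q.map (Int.castRingHom ℂ)).mahlerMeasure :=
      zero_lt_one.trans_le (Polynomial.one_le_mahlerMeasure_of_ne_zero hq0)
    have hB0 : 0 < (K : ℝ) * ‖ξ‖ + 1 := by positivity
    have hL0 : 0 ≤ Real.log ((K : ℝ) * ‖ξ‖ + 1) :=
      Real.log_nonneg (by nlinarith [norm_nonneg ξ])
    have hrew : Real.exp (-W) * ((K : ℝ) * ‖ξ‖ + 1) ^ q.natDegree *
        (q.map (Int.castRingHom ℂ)).mahlerMeasure =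
        Real.exp (-W + q.natDegree * Real.log ((K : ℝ) * ‖ξ‖ + 1) +
          Real.log (q.map (Int.castRingHom ℂ)).mahlerMeasure) := by
      rw [Real.exp_add, Real.exp_add, Real.exp_nat_mul, Real.exp_log hB0, Real.exp_log hM0]
    refine hQval.trans ?_
    rw [hrew, Real.exp_le_exp]
    have h7 : (q.natDegree : ℝ) * Real.log ((K : ℝ) * ‖ξ‖ + 1) ≤
        20 * D₀ / K * Real.log ((K : ℝ) * ‖ξ‖ + 1) := mul_le_mul_of_nonneg_right hqd hL0
    linarith

end Summit.Schanuel.Schanuel.Theorems
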